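/-
Copyright (c) 2026 the pub-hodgecm-mathlib formalisation cell (harness21).  Prover seat hodgecm-mathlib-LH4-p04 (g0), req620 Track A «(D-RAM) FOUR-FRAME» squad
(unit U3_Laws, stub `stub_U3_stableModelSum` (MS), ROAD A; LH4-p10 (g0)'s brick list `MS-ROAD-A-BRICKS.v1` brick 2 (3c-ii) «WEIGHT = STABILISER INDEX»; dealer LH4-plan (g10)
WORD #41 (2)).  2026-09-03.
-/
import Literature.NumberTheory.Automorphic.UnitaryLatticeTreeDual    -- ★ (B-p14): `latt_le_latt_iff`; brings ★ `UnitaryLatticeTreeDefs` (`latt`, `latt_mul`, `mapGL`, `IsIntMatrix`)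
import HarnessLib

/-!
# Crux `H413`, line LH4 «(D-RAM) FOUR-FRAME» road — unit U3_Laws (iii), ROAD A (MS) TIER 2 SUPPORT: THE DIAGONAL STABILISER OF A LATTICE IS AN ORDER
# (closed under `+`, `·`, `−`, contains the integral scalars; for `latt V` it is the conjugate-integrality set `{u | V⁻¹·diag(u)·V ∈ M_N(𝒪)}`)

Cell `hodgecm-mathlib` (D-0151), FLOOR 0, crux item H413 = `stmt-HodgeConjecture-24833`, route of record `HCCMUnconditional`; squad F0∕P3c∕LH4 (req618∕req620).  THEOREMS ONLY
(no `def`, no instance, no notation, no `sorry`, default heartbeats); lane `--supports stmt-HodgeConjecture-24833 --as helper` (count-neutral).  Diagonal-model currency of ★ p855032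
(`T = diag(s)`), here in MATRIX-ACTION form so that non-unit diagonal entries and sums make sense: for `u : Fin N → K` the action of `diag(u)` on an `𝒪`-submodule
`M ≤ K^N` is `M.map (toLin' (Matrix.diagonal u))` (for unit `u` this IS ★ `mapGL ⟨diag u⟩ M`, §3).

WHAT IS PROVED (generic `N`, any valued field `K`, ANY `𝒪`-submodule `M ≤ K^N`).  The DIAGONAL STABILISER `Λ(M) := {u : K^N | diag(u)·M ⊆ M}` is a subring of the
product ring `K^N` containing the diagonal image of `𝒪` and stable under `𝒪`-scaling — an `𝒪`-ORDER of `K^N` when `M` is a lattice (LH4-p10 (g0)'s «`Λ_S`», whose unit group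
is the stabiliser of `M` in the diagonal torus and whose index is the orbit WEIGHT of step (3c) of the (S-fin) road):
* §1 `diag_add_stable`, `diag_mul_stable`, `diag_neg_stable`, `diag_zero_stable`, `diag_const_stable` (`|a| ≤ 1`), `diag_one_stable`, `diag_smul_stable` (`|c| ≤ 1`) and the
  packaging `exists_subring_mem_iff_diag_stable` (`∃ R : Subring (Fin N → K), ∀ u, u ∈ R ↔ diag(u)·M ⊆ M`);
* §2 `diag_stable_latt_iff_isIntMatrix` — for `M = latt V` (`V` invertible): `diag(u)·latt V ⊆ latt V ⟺ V⁻¹·diag(u)·V ∈ M_N(𝒪)` (★ `latt_mul`, ★ `latt_le_latt_iff`; the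
  `𝒪`-linearity in `u` of ★ p855216's conjugate-integrality reading);
* §3 `mapGL_le_iff_diag_stable` — the GL reading for unit `u` (`mapGL T M ≤ M ⟺ diag(u)·M ⊆ M`, `T = diag(u)`), and `sigmaFixed_diag_stable_closed` — the σ-FIXED INTEGRAL
  stabiliser `{u | σ uᵢ = uᵢ, |uᵢ| ≤ 1, diag(u)·M ⊆ M}` of p10's list is closed under `+` and `·` and contains the σ-fixed integral constants.
HONEST LABEL.  Count-neutral; nothing printed is asserted; the census laws (MS) stay PROVER TARGETS; `HC_CM` is proved only modulo the 7 printed citations (2 remaining named inputs: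
hLiu418 = `stmt-HodgeConjecture-24832`, h413 = `stmt-HodgeConjecture-24833`) until rung 0 closes.

## References
* [Kottwitz1986BaseChangeUnits] R. E. Kottwitz, *Base change for unit elements of Hecke algebras*, Compositio Math. 60 (1986), §1 pp. 240–241 (lattices fixed by a torus; orders).
* [Serre1980Trees] J.-P. Serre, *Trees*, Springer (1980), Ch. II §1.1 (lattices, the action of diagonal elements, stabilisers).
* [BruhatTits1972] F. Bruhat, J. Tits, *Groupes réductifs sur un corps local I*, Publ. Math. IHÉS 41 (1972), §10.
-/

set_option autoImplicit false

noncomputable section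

namespace Summit.HodgeConjecture.HodgeConjecture.Cruxes.H413.F0P3cDyRamDiagonalStabiliserOrder

open Matrix
open Literature.NumberTheory.Automorphic Literature.NumberTheory.Automorphic.HermitianLattice Literature.NumberTheory.Automorphic.UnitaryGroup
open Literature.NumberTheory.Automorphic.UnitaryLatticeTree
open scoped Valued WithZero Matrix MatrixGroups

variable {K : Type*} [Field K] [Valued K ℤᵐ⁰] {N : ℕ}

/-! ## §1  The diagonal stabiliser of an `𝒪`-submodule is a subring containing `𝒪` -/

section Order

variable (M : Submodule 𝒪[K] (Fin N → K))

/-- Membership form of `diag(u)·M ⊆ M`: every `x ∈ M` has `diag(u)·x ∈ M`. [cite: Serre1980Trees, II §1.1] -/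
theorem diag_stable_iff (u : Fin N → K) :
    M.map ((Matrix.toLin' (Matrix.diagonal u)).restrictScalars 𝒪[K]) ≤ M ↔ ∀ x ∈ M, (Matrix.diagonal u).mulVec x ∈ M := by
  rw [Submodule.map_le_iff_le_comap]
  refine ⟨fun h x hx => ?_, fun h x hx => ?_⟩
  · have := h hx
    rwa [Submodule.mem_comap, LinearMap.restrictScalars_apply, Matrix.toLin'_apply] at this
  · rw [Submodule.mem_comap, LinearMap.restrictScalars_apply, Matrix.toLin'_apply]
    exact h x hx

/-- **Closed under `+`**: `diag(u)·M ⊆ M`, `diag(u′)·M ⊆ M ⇒ diag(u + u′)·M ⊆ M`. [cite: Kottwitz1986BaseChangeUnits, §1 pp. 240–241] -/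
theorem diag_add_stable {u u' : Fin N → K}
    (hu : M.map ((Matrix.toLin' (Matrix.diagonal u)).restrictScalars 𝒪[K]) ≤ M) (hu' : M.map ((Matrix.toLin' (Matrix.diagonal u')).restrictScalars 𝒪[K]) ≤ M) :
    M.map ((Matrix.toLin' (Matrix.diagonal (u + u'))).restrictScalars 𝒪[K]) ≤ M := by
  rw [diag_stable_iff] at hu hu' ⊢
  intro x hx
  have h : Matrix.diagonal (u + u') = Matrix.diagonal u + Matrix.diagonal u' := (Matrix.diagonal_add u u').symm
  rw [h, Matrix.add_mulVec]
  exact M.add_mem (hu x hx) (hu' x hx)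

/-- **Closed under `·`**: `diag(u)·M ⊆ M`, `diag(u′)·M ⊆ M ⇒ diag(u·u′)·M ⊆ M` (`diag(u·u′) = diag(u)·diag(u′)`). [cite: Kottwitz1986BaseChangeUnits, §1 pp. 240–241] -/
theorem diag_mul_stable {u u' : Fin N → K}
    (hu : M.map ((Matrix.toLin' (Matrix.diagonal u)).restrictScalars 𝒪[K]) ≤ M) (hu' : M.map ((Matrix.toLin' (Matrix.diagonal u')).restrictScalars 𝒪[K]) ≤ M) :
    M.map ((Matrix.toLin' (Matrix.diagonal (u * u'))).restrictScalars 𝒪[K]) ≤ M := by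
  rw [diag_stable_iff] at hu hu' ⊢
  intro x hx
  have h : Matrix.diagonal (u * u') = Matrix.diagonal u * Matrix.diagonal u' := (Matrix.diagonal_mul_diagonal u u').symm
  rw [h, ← Matrix.mulVec_mulVec]
  exact hu _ (hu' x hx)

/-- **Closed under negation**: `diag(u)·M ⊆ M ⇒ diag(−u)·M ⊆ M`. [cite: Serre1980Trees, II §1.1] -/
theorem diag_neg_stable {u : Fin N → K} (hu : M.map ((Matrix.toLin' (Matrix.diagonal u)).restrictScalars 𝒪[K]) ≤ M) :
    M.map ((Matrix.toLin' (Matrix.diagonal (-u))).restrictScalars 𝒪[K]) ≤ M := by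
  rw [diag_stable_iff] at hu ⊢
  intro x hx
  have h : Matrix.diagonal (-u) = -Matrix.diagonal u := (Matrix.diagonal_neg u).symm
  rw [h, Matrix.neg_mulVec]
  exact M.neg_mem (hu x hx)

/-- `diag(0)·M = 0 ⊆ M`. [cite: Serre1980Trees, II §1.1] -/
theorem diag_zero_stable : M.map ((Matrix.toLin' (Matrix.diagonal (0 : Fin N → K))).restrictScalars 𝒪[K]) ≤ M := by
  rw [diag_stable_iff]
  intro x _
  have h : Matrix.diagonal (0 : Fin N → K) = 0 := Matrix.diagonal_zero
  rw [h, Matrix.zero_mulVec]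
  exact M.zero_mem

/-- **The integral scalars lie in the stabiliser**: for `|a| ≤ 1`, `diag(a, …, a)·M = a·M ⊆ M`. [cite: Serre1980Trees, II §1.1] -/
theorem diag_const_stable {a : K} (ha : Valued.v a ≤ 1) : M.map ((Matrix.toLin' (Matrix.diagonal fun _ : Fin N => a)).restrictScalars 𝒪[K]) ≤ M := by
  rw [diag_stable_iff]
  intro x hx
  have h : (Matrix.diagonal fun _ : Fin N => a).mulVec x = a • x := by
    funext i; rw [Matrix.mulVec_diagonal, Pi.smul_apply, smul_eq_mul]
  rw [h]
  exact M.smul_mem (⟨a, ha⟩ : 𝒪[K]) hx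

/-- `diag(1)·M ⊆ M`. [cite: Serre1980Trees, II §1.1] -/
theorem diag_one_stable : M.map ((Matrix.toLin' (Matrix.diagonal (1 : Fin N → K))).restrictScalars 𝒪[K]) ≤ M :=
  diag_const_stable M (a := 1) (by rw [map_one])

/-- **Stable under `𝒪`-scaling**: for `|c| ≤ 1`, `diag(u)·M ⊆ M ⇒ diag(c·u)·M ⊆ M`. [cite: Kottwitz1986BaseChangeUnits, §1 pp. 240–241] -/
theorem diag_smul_stable {c : K} (hc : Valued.v c ≤ 1) {u : Fin N → K} (hu : M.map ((Matrix.toLin' (Matrix.diagonal u)).restrictScalars 𝒪[K]) ≤ M) :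
    M.map ((Matrix.toLin' (Matrix.diagonal (c • u))).restrictScalars 𝒪[K]) ≤ M := by
  have h : c • u = (fun _ : Fin N => c) * u := by funext i; rw [Pi.smul_apply, Pi.mul_apply, smul_eq_mul]
  rw [h]
  exact diag_mul_stable M (diag_const_stable M hc) hu

/-- **THE DIAGONAL STABILISER IS A SUBRING OF `K^N`** (packaging of §1): there is a subring `R ≤ K^N` with `u ∈ R ⟺ diag(u)·M ⊆ M`; by `diag_const_stable` ∕ `diag_smul_stable` it
contains the diagonal `𝒪` and is an `𝒪`-submodule — an `𝒪`-order of `K^N` when `M` is a lattice (its unit group is the stabiliser of `M` in the diagonal torus).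
[cite: Kottwitz1986BaseChangeUnits, §1 pp. 240–241] [cite: Serre1980Trees, II §1.1] -/
theorem exists_subring_mem_iff_diag_stable :
    ∃ R : Subring (Fin N → K), ∀ u, u ∈ R ↔ M.map ((Matrix.toLin' (Matrix.diagonal u)).restrictScalars 𝒪[K]) ≤ M := by
  refine ⟨{ carrier := {u | M.map ((Matrix.toLin' (Matrix.diagonal u)).restrictScalars 𝒪[K]) ≤ M}
            mul_mem' := fun hu hu' => diag_mul_stable M hu hu'
            one_mem' := diag_one_stable M
            add_mem' := fun hu hu' => diag_add_stable M hu hu'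
            zero_mem' := diag_zero_stable M
            neg_mem' := fun hu => diag_neg_stable M hu }, fun u => Iff.rfl⟩

end Order

/-! ## §2  For `M = latt V`: the stabiliser is the conjugate-integrality set -/

/-- **`diag(u)·latt V ⊆ latt V ⟺ V⁻¹·diag(u)·V` IS INTEGRAL** (`V` invertible): ★ `latt_mul` (`diag(u)·latt V = latt (diag(u)·V)`) and ★ `latt_le_latt_iff`.  The map
`u ↦ V⁻¹·diag(u)·V` is `K`-linear, which is §1's closure read in coordinates (★ p855216 `isIntMatrix_conj_hnf_iff` computes it on the HNF frame for unit `u`).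
[cite: Serre1980Trees, II §1.1] [cite: Kottwitz1986BaseChangeUnits, §1 pp. 240–241] -/
theorem diag_stable_latt_iff_isIntMatrix {V : Matrix (Fin N) (Fin N) K} (hV : IsUnit V.det) (u : Fin N → K) :
    (latt V).map ((Matrix.toLin' (Matrix.diagonal u)).restrictScalars 𝒪[K]) ≤ latt V ↔ IsIntMatrix (V⁻¹ * Matrix.diagonal u * V) := by
  rw [← latt_mul, latt_le_latt_iff hV, Matrix.mul_assoc]

/-! ## §3  The GL reading for units, and the σ-fixed integral stabiliser -/

/-- For a diagonal GL element `T = diag(u)`: `mapGL T M ≤ M ⟺ diag(u)·M ⊆ M` (★ `mapGL` is the matrix action). [cite: Serre1980Trees, II §1.1] -/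
theorem mapGL_le_iff_diag_stable (T : GL (Fin N) K) {u : Fin N → K} (hT : (T : Matrix (Fin N) (Fin N) K) = Matrix.diagonal u)
    (M : Submodule 𝒪[K] (Fin N → K)) :
    mapGL T M ≤ M ↔ M.map ((Matrix.toLin' (Matrix.diagonal u)).restrictScalars 𝒪[K]) ≤ M := by
  rw [mapGL, hT]

/-- **THE σ-FIXED INTEGRAL STABILISER IS CLOSED** (LH4-p10 (g0)'s «`Λ_S`», brick (3c-ii) as listed): the set
`S(M) = {u | (∀ i, σ uᵢ = uᵢ ∧ |uᵢ| ≤ 1) ∧ diag(u)·M ⊆ M}` is closed under `+` and `·` and contains the constant vector of every σ-fixed integral scalar `a`.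
[cite: Kottwitz1986BaseChangeUnits, §1 pp. 240–241] [cite: BruhatTits1972, §10] -/
theorem sigmaFixed_diag_stable_closed (σ : K →+* K) (M : Submodule 𝒪[K] (Fin N → K)) :
    (∀ u u' : Fin N → K,
      ((∀ i, σ (u i) = u i ∧ Valued.v (u i) ≤ 1) ∧ M.map ((Matrix.toLin' (Matrix.diagonal u)).restrictScalars 𝒪[K]) ≤ M) →
      ((∀ i, σ (u' i) = u' i ∧ Valued.v (u' i) ≤ 1) ∧ M.map ((Matrix.toLin' (Matrix.diagonal u')).restrictScalars 𝒪[K]) ≤ M) →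
        ((∀ i, σ ((u + u') i) = (u + u') i ∧ Valued.v ((u + u') i) ≤ 1) ∧ M.map ((Matrix.toLin' (Matrix.diagonal (u + u'))).restrictScalars 𝒪[K]) ≤ M) ∧
        ((∀ i, σ ((u * u') i) = (u * u') i ∧ Valued.v ((u * u') i) ≤ 1) ∧ M.map ((Matrix.toLin' (Matrix.diagonal (u * u'))).restrictScalars 𝒪[K]) ≤ M)) ∧
    (∀ a : K, σ a = a → Valued.v a ≤ 1 →
      (∀ i, σ ((fun _ : Fin N => a) i) = (fun _ : Fin N => a) i ∧ Valued.v ((fun _ : Fin N => a) i) ≤ 1) ∧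
        M.map ((Matrix.toLin' (Matrix.diagonal fun _ : Fin N => a)).restrictScalars 𝒪[K]) ≤ M) := by
  refine ⟨fun u u' hu hu' => ⟨⟨fun i => ⟨?_, ?_⟩, diag_add_stable M hu.2 hu'.2⟩, ⟨fun i => ⟨?_, ?_⟩, diag_mul_stable M hu.2 hu'.2⟩⟩,
    fun a hσa ha => ⟨fun _ => ⟨hσa, ha⟩, diag_const_stable M ha⟩⟩
  · rw [Pi.add_apply, map_add, (hu.1 i).1, (hu'.1 i).1]
  · rw [Pi.add_apply]; exact (Valuation.map_add _ _ _).trans (max_le (hu.1 i).2 (hu'.1 i).2)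
  · rw [Pi.mul_apply, map_mul, (hu.1 i).1, (hu'.1 i).1]
  · rw [Pi.mul_apply, map_mul]; exact mul_le_one' (hu.1 i).2 (hu'.1 i).2

end Summit.HodgeConjecture.HodgeConjecture.Cruxes.H413.F0P3cDyRamDiagonalStabiliserOrder

end
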